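import Literature.Topology.SheafOpenRestriction
import Literature.Algebra.Homology.CartanCriterion
import Literature.AlgebraicGeometry.Motives.FlasqueCohomology
import Mathlib.Algebra.Homology.DerivedCategory.Ext.Map
import Mathlib.Algebra.FiveLemma
import HarnessLib

/-!
# The cohomology of an open subspace is computed on the ambient site

[StacksProject, Tag 01E1 = Cohomology of Sheaves, Lemma 20.7.1(2)]: for a ringed space `X`, an open
`U ⊆ X` and an `𝒪_X`-module `F`, "`Hᵖ(U, ℱ) = Hᵖ(U, ℱ|_U)`" — the cohomology of the object `U` of
the site of `X` (the derived functors of `Γ(U, –)` on sheaves on `X`, i.e. `Extᵖ_X(ℤ[h_U], F)`,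
Mathlib's `Sheaf.cohomologyPresheaf`) agrees with the sheaf cohomology of the space `U` with
coefficients in the restricted sheaf; the site-theoretic form is [StacksProject, Tag 03F3 =
Cohomology on Sites, Lemma 21.7.1(2)] "`Hᵖ(U, ℱ) = Hᵖ(𝒞/U, ℱ|_{𝒞/U})`".

We prove this for abelian sheaves and an arbitrary open embedding `f : Y ⟶ X` of topological spaces
with image `U₀ = f(Y)` (`IsOpenEmbedding f`; restriction `res hf = Topology.restrict hf Ab` from
`Literature/Topology/SheafOpenRestriction`), in the language of this cluster
(`ℤ[h_U] = freeSheaf J U`, `Literature/Algebra/Homology/CartanCriterion`):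

* `freeSheafTopIso` — **`ℤ[h_⊤] ≅ ℤ[h_{U₀}]|_Y`** on `Y` (reindex the free presheaves, then Mathlib's
  compatibility of sheafification with restriction along a cocontinuous-and-continuous functor,
  `Functor.pushforwardContinuousSheafificationCompatibility`), and `constantSheafIsoRes` —
  **`ℤ_Y ≅ ℤ[h_{U₀}]|_Y`**;
* `res_map_bijective` — degree `0`: `Hom_X(ℤ[h_{U₀}], F) → Hom_Y(ℤ[h_{U₀}]|_Y, F|_Y)` is bijective
  (both sides are `F(U₀)`, `evalGen_bijective`);
* `isFlasque_res`, `subsingleton_ext_res_of_injective` — the restriction of a flasque (e.g. injective)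
  sheaf is flasque, hence `Extⁿ⁺¹_Y(ℤ[h_{U₀}]|_Y, I|_Y) = Hⁿ⁺¹(Y, I|_Y) = 0`
  (`Literature/AlgebraicGeometry/Motives/FlasqueCohomology`, Hartshorne III.2.5);
* `mapExt_bijective` — **main theorem**: for every abelian sheaf `F` on `X` and every `n`, the map
  `Extⁿ_X(ℤ[h_{U₀}], F) → Extⁿ_Y(ℤ[h_{U₀}]|_Y, F|_Y)` induced by the exact functor `res hf`
  (`Functor.mapExtAddHom`) is bijective. Proof by dimension shifting along `0 → F → I → Q → 0` with
  `I` injective, exactly as Mathlib's `Functor.mapExt_bijective_of_preservesInjectiveObjects` but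
  with "`res` preserves injectives" replaced by "`res I` is flasque, hence acyclic" (restriction to an
  open does preserve injectives — Tag 01E1(1) — but flasqueness is what this tree has).

Universe: everything at one level `u` (`X Y : TopCat.{u}`, `Ab.{u}`, `Ext.{u}`), the level at which
`Motives.subsingleton_H_of_isFlasque` is stated.

## Where this is used

`Literature/AlgebraicGeometry/Crystalline/HodgeDeRhamGenericFibreReduction` reduces Deligne's
degeneration mod torsion to a statement about the kernel of restriction
`HyperExt_𝒳(ℤ, Ωⁿ) → HyperExt_U(ℤ, Ωⁿ|_U)` to the generic fibre `U = 𝒳[1/p]`; with this file that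
kernel is the kernel of `Extⁿ_𝒳(ℤ[h_⊤], Ωⁿ) → Extⁿ_𝒳(ℤ[h_U], Ωⁿ)`, a question on the site of `𝒳`
alone ("cohomology and localization").

## References

* [StacksProject] The Stacks Project, Tag 01E1 (Cohomology of Sheaves, Lemma 20.7.1), Tag 03F3
  (Cohomology on Sites, Lemma 21.7.1).
* [Hartshorne1977] R. Hartshorne, *Algebraic Geometry*, GTM 52, III.2.4–2.5 (flasque sheaves are
  acyclic).
-/

noncomputable section

open CategoryTheory CategoryTheory.Limits CategoryTheory.Abelian TopologicalSpace Topology Opposite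
open Literature.Algebra.Homology

universe u

namespace Literature.Topology

namespace OpenSubspaceCohomology

variable {X Y : TopCat.{u}} {f : Y ⟶ X} (hf : IsOpenEmbedding f)

/-- The functor `V ↦ f(V)`, `Opens Y ⥤ Opens X`. [folklore] -/
abbrev ι : Opens Y ⥤ Opens X := hf.isOpenMap.functor

/-- The image `U₀ = f(Y)` of the embedding, an open of `X`. [folklore] -/
abbrev U₀ : Opens X := (ι hf).obj ⊤

/-- Restriction of abelian sheaves along `f` (`Topology.restrict`). [folklore] -/
abbrev res : Sheaf (Opens.grothendieckTopology X) AddCommGrpCat.{u} ⥤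
    Sheaf (Opens.grothendieckTopology Y) AddCommGrpCat.{u} :=
  restrict hf AddCommGrpCat.{u}

/-- Restriction is additive (`Topology.additive_restrict`). [folklore] -/
instance : (res hf).Additive := additive_restrict hf

/-- Restriction is left exact (`Topology.preservesFiniteLimits_restrict`). [folklore] -/
instance : PreservesFiniteLimits (res hf) := preservesFiniteLimits_restrict hf

/-- Restriction is right exact (`Topology.preservesFiniteColimits_restrict`). [folklore] -/
instance : PreservesFiniteColimits (res hf) := preservesFiniteColimits_restrict hf

/-- The coefficient group `ℤ` (as `ULift ℤ`, Mathlib's convention for `Sheaf.H`). [folklore] -/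
abbrev Zu : AddCommGrpCat.{u} := AddCommGrpCat.of (ULift.{u} ℤ)

/-! ### Restriction of a flasque sheaf is flasque -/

/-- **The restriction of a flasque sheaf to an open subspace is flasque** (its restriction maps are
among those of the sheaf). [folklore] -/
theorem isFlasque_res (I : Sheaf (Opens.grothendieckTopology X) AddCommGrpCat.{u})
    [TopCat.Sheaf.IsFlasque I] : TopCat.Sheaf.IsFlasque ((res hf).obj I) where
  epi i := (inferInstance : Epi (I.obj.map ((ι hf).op.map i)))

/-! ### `ℤ[h_⊤]` on `Y` is the restriction of `ℤ[h_{U₀}]` -/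

/-- `(W ⟶ ⊤) ≃ (f(W) ⟶ U₀)` (both singletons), with the types spelled as values of `yoneda`.
[folklore] -/
def homTopEquiv (W : (Opens Y)ᵒᵖ) :
    ((yoneda.obj (⊤ : Opens Y)).obj W) ≃ ((yoneda.obj (U₀ hf)).obj ((ι hf).op.obj W)) where
  toFun g := (ι hf).map g
  invFun _ := homOfLE le_top
  left_inv _ := Subsingleton.elim (α := W.unop ⟶ ⊤) _ _
  right_inv _ := Subsingleton.elim (α := (ι hf).obj W.unop ⟶ U₀ hf) _ _

/-- Reindexing a coproduct of copies of `M` along a map of (one-element) index sets. [folklore] -/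
abbrev reidx (M : AddCommGrpCat.{u}) {α β : Type u} (p : α → β) :
    (∐ fun _ : α => M) ⟶ ∐ fun _ : β => M :=
  Sigma.map' p fun _ => 𝟙 M

/-- `reidx` on a summand. [folklore] -/
theorem ι_reidx (M : AddCommGrpCat.{u}) {α β : Type u} (p : α → β) (a : α) :
    Sigma.ι (fun _ : α => M) a ≫ reidx M p = Sigma.ι (fun _ : β => M) (p a) := by
  rw [reidx, Sigma.ι_comp_map', Category.id_comp]

/-- `reidx` along maps into a subsingleton only depends on the source summand. [folklore] -/
theorem ι_reidx_reidx (M : AddCommGrpCat.{u}) {α β γ : Type u} (hγ : ∀ x y : γ, x = y) (p : α → β)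
    (q : β → γ) (p' : α → γ) (a : α) :
    Sigma.ι (fun _ : α => M) a ≫ reidx M p ≫ reidx M q =
      Sigma.ι (fun _ : α => M) a ≫ reidx M p' := by
  rw [← Category.assoc, ι_reidx, ι_reidx, ι_reidx, hγ (q (p a)) (p' a)]

/-- **The free presheaf on `⊤ ∈ Opens Y` is the restriction of the free presheaf on `U₀ = f(Y)`**:
`(W ↦ ⊕_{W → ⊤} M) ≅ (W ↦ ⊕_{f(W) → U₀} M)`, by reindexing the (one-element) index sets.
[folklore] -/
def freeYonedaPresheafIso (M : AddCommGrpCat.{u}) :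
    Presheaf.freeYoneda (⊤ : Opens Y) M ≅ (ι hf).op ⋙ Presheaf.freeYoneda (U₀ hf) M :=
  NatIso.ofComponents
    (fun W =>
      { hom := reidx M (homTopEquiv hf W)
        inv := reidx M (homTopEquiv hf W).symm
        hom_inv_id := by
          show reidx M _ ≫ reidx M _ = 𝟙 (∐ fun _ : (yoneda.obj (⊤ : Opens Y)).obj W => M)
          apply Sigma.hom_ext
          intro i
          rw [Category.comp_id, ← Category.assoc, ι_reidx, ι_reidx, Equiv.symm_apply_apply]
        inv_hom_id := by
          show reidx M _ ≫ reidx M _ =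
            𝟙 (∐ fun _ : (yoneda.obj (U₀ hf)).obj ((ι hf).op.obj W) => M)
          apply Sigma.hom_ext
          intro i
          rw [Category.comp_id, ← Category.assoc, ι_reidx, ι_reidx, Equiv.apply_symm_apply] })
    (fun {W W'} g => by
      apply Sigma.hom_ext
      intro i
      simp only [Functor.comp_map, Functor.op_map, Presheaf.freeYoneda_map]
      show Sigma.ι (fun _ => M) i ≫ reidx M _ ≫ reidx M _ =
        Sigma.ι (fun _ => M) i ≫ reidx M _ ≫ reidx M _
      have hγ : ∀ x y : (yoneda.obj (U₀ hf)).obj ((ι hf).op.obj W'), x = y :=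
        fun x y => Subsingleton.elim (α := (ι hf).obj W'.unop ⟶ U₀ hf) x y
      exact (ι_reidx_reidx M hγ _ _
        (fun i => (ι hf).map ((yoneda.obj (⊤ : Opens Y)).map g i)) i).trans
        (ι_reidx_reidx M hγ _ _ _ i).symm)

/-- **`ℤ[h_⊤] ≅ ℤ[h_{U₀}]|_Y`**: the free abelian sheaf on `⊤ ∈ Opens Y` is the restriction of the
free abelian sheaf on `U₀ = f(Y) ∈ Opens X` (sheafify `freeYonedaPresheafIso`, restriction commutes
with sheafification: Mathlib `Functor.pushforwardContinuousSheafificationCompatibility`).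
[folklore] -/
def freeSheafTopIso : freeSheaf.{u} (Opens.grothendieckTopology Y) (⊤ : Opens Y) ≅
    (res hf).obj (freeSheaf.{u} (Opens.grothendieckTopology X) (U₀ hf)) :=
  haveI := isCocontinuous_functor hf
  haveI := hf.functor_isContinuous
  (presheafToSheaf _ _).mapIso (freeYonedaPresheafIso hf Zu) ≪≫
    ((ι hf).pushforwardContinuousSheafificationCompatibility AddCommGrpCat.{u}
      (Opens.grothendieckTopology Y) (Opens.grothendieckTopology X)).app
      (Presheaf.freeYoneda (U₀ hf) Zu)

/-- The universal section `gen ∈ ℤ[h_{U₀}](U₀)` (the image of `𝟙`): `freeSheafHomEquiv φ = φ_{U₀}(gen)`.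
[folklore] -/
def gen : (freeSheaf.{u} (Opens.grothendieckTopology X) (U₀ hf)).obj.obj (op (U₀ hf)) :=
  freeSheafHomEquiv (U₀ hf) _ (𝟙 _)

/-- `freeSheafHomEquiv φ = φ_{U₀}(gen)`. [folklore] -/
theorem freeSheafHomEquiv_eq_app_gen (F : Sheaf (Opens.grothendieckTopology X) AddCommGrpCat.{u})
    (φ : freeSheaf.{u} (Opens.grothendieckTopology X) (U₀ hf) ⟶ F) :
    freeSheafHomEquiv (U₀ hf) F φ = φ.hom.app (op (U₀ hf)) (gen hf) := by
  rw [gen, ← freeSheafHomEquiv_comp, Category.id_comp]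

/-- **The isomorphism `ℤ[h_⊤] ≅ ℤ[h_{U₀}]|_Y` maps the universal section of `ℤ[h_⊤]` to `gen`**
(Mathlib `Functor.toSheafify_pullbackSheafificationCompatibility`). [folklore] -/
theorem freeSheafHomEquiv_freeSheafTopIso_hom :
    freeSheafHomEquiv (⊤ : Opens Y) _ (freeSheafTopIso hf).hom = gen hf := by
  haveI := isCocontinuous_functor hf
  haveI := hf.functor_isContinuous
  -- both sides are `uliftZMultiplesAddEquiv` of a morphism `ℤ ⟶ ℤ[h_{U₀}](U₀)`
  simp only [gen, freeSheafHomEquiv, Equiv.trans_apply, AddEquiv.toEquiv_eq_coe, AddEquiv.coe_toEquiv]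
  congr 1
  change Sigma.ι (fun _ : ((⊤ : Opens Y) ⟶ ⊤) => Zu) (𝟙 _) ≫
      (toSheafify _ (Presheaf.freeYoneda (⊤ : Opens Y) Zu) ≫ (freeSheafTopIso hf).hom.hom).app
        (op ⊤) =
    Sigma.ι (fun _ : (U₀ hf ⟶ U₀ hf) => Zu) (𝟙 _) ≫
      (toSheafify _ (Presheaf.freeYoneda (U₀ hf) Zu) ≫
        (𝟙 (freeSheaf (Opens.grothendieckTopology X) (U₀ hf)) : freeSheaf _ _ ⟶ _).hom).app
        (op (U₀ hf))
  have h1 : (freeSheafTopIso hf).hom.hom =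
      sheafifyMap _ (freeYonedaPresheafIso hf Zu).hom ≫
        (((ι hf).pushforwardContinuousSheafificationCompatibility AddCommGrpCat.{u}
          (Opens.grothendieckTopology Y) (Opens.grothendieckTopology X)).hom.app
          (Presheaf.freeYoneda (U₀ hf) Zu)).hom := rfl
  have key : toSheafify _ (Presheaf.freeYoneda (⊤ : Opens Y) Zu) ≫ (freeSheafTopIso hf).hom.hom =
      (freeYonedaPresheafIso hf Zu).hom ≫
        Functor.whiskerLeft (ι hf).op (toSheafify _ (Presheaf.freeYoneda (U₀ hf) Zu)) := by
    rw [h1]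
    erw [← Category.assoc, ← toSheafify_naturality, Category.assoc]
    congr 1
    exact Functor.toSheafify_pullbackSheafificationCompatibility _ _ _ _ _
  erw [key, Category.comp_id]
  rw [NatTrans.comp_app, Functor.whiskerLeft_app]
  show Sigma.ι (fun _ => Zu) (𝟙 ⊤) ≫ reidx Zu (homTopEquiv hf (op ⊤)) ≫
    (toSheafify _ (Presheaf.freeYoneda (U₀ hf) Zu)).app (op ((ι hf).obj ⊤)) = _
  rw [← Category.assoc, ι_reidx]
  show Sigma.ι (fun _ => Zu) ((ι hf).map (𝟙 ⊤)) ≫ _ = _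
  erw [CategoryTheory.Functor.map_id]
  rfl

/-! ### Degree `0`: morphisms out of `ℤ[h_{U₀}]` and out of its restriction -/

/-- Evaluation at the universal section: `(ℤ[h_{U₀}]|_Y ⟶ G) → G(⊤)`, `ψ ↦ ψ_⊤(gen)`. [folklore] -/
def evalGen (G : Sheaf (Opens.grothendieckTopology Y) AddCommGrpCat.{u})
    (ψ : (res hf).obj (freeSheaf.{u} (Opens.grothendieckTopology X) (U₀ hf)) ⟶ G) :
    G.obj.obj (op ⊤) :=
  ψ.hom.app (op ⊤) (gen hf)

/-- `evalGen` is `freeSheafHomEquiv` after composing with `ℤ[h_⊤] ≅ ℤ[h_{U₀}]|_Y`. [folklore] -/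
theorem evalGen_eq (G : Sheaf (Opens.grothendieckTopology Y) AddCommGrpCat.{u})
    (ψ : (res hf).obj (freeSheaf.{u} (Opens.grothendieckTopology X) (U₀ hf)) ⟶ G) :
    evalGen hf G ψ = freeSheafHomEquiv (⊤ : Opens Y) G ((freeSheafTopIso hf).hom ≫ ψ) := by
  rw [freeSheafHomEquiv_comp, freeSheafHomEquiv_freeSheafTopIso_hom]
  rfl

/-- **Morphisms out of `ℤ[h_{U₀}]|_Y` are determined by the image of `gen`**, bijectively with
`G(⊤)`. [folklore] -/
theorem evalGen_bijective (G : Sheaf (Opens.grothendieckTopology Y) AddCommGrpCat.{u}) :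
    Function.Bijective (evalGen hf G) := by
  have h : evalGen hf G = freeSheafHomEquiv (⊤ : Opens Y) G ∘
      fun ψ => (freeSheafTopIso hf).hom ≫ ψ := funext (evalGen_eq hf G)
  rw [h]
  refine (freeSheafHomEquiv (⊤ : Opens Y) G).bijective.comp (Equiv.bijective
    { toFun := fun ψ => (freeSheafTopIso hf).hom ≫ ψ
      invFun := fun χ => (freeSheafTopIso hf).inv ≫ χ
      left_inv := fun ψ => by simp
      right_inv := fun χ => by simp })

/-- `evalGen (φ|_Y) = freeSheafHomEquiv φ` (both are `φ_{U₀}(gen)`). [folklore] -/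
theorem evalGen_res_map (F : Sheaf (Opens.grothendieckTopology X) AddCommGrpCat.{u})
    (φ : freeSheaf.{u} (Opens.grothendieckTopology X) (U₀ hf) ⟶ F) :
    evalGen hf ((res hf).obj F) ((res hf).map φ) = freeSheafHomEquiv (U₀ hf) F φ := by
  rw [freeSheafHomEquiv_eq_app_gen]
  rfl

/-- **Restriction is bijective on morphisms out of `ℤ[h_{U₀}]`**:
`Hom_X(ℤ[h_{U₀}], F) → Hom_Y(ℤ[h_{U₀}]|_Y, F|_Y)` is a bijection (both sides are `F(U₀)`).
[folklore] -/
theorem res_map_bijective (F : Sheaf (Opens.grothendieckTopology X) AddCommGrpCat.{u}) :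
    Function.Bijective fun φ : freeSheaf.{u} (Opens.grothendieckTopology X) (U₀ hf) ⟶ F =>
      (res hf).map φ := by
  have h : evalGen hf ((res hf).obj F) ∘ (fun φ => (res hf).map φ) = freeSheafHomEquiv (U₀ hf) F :=
    funext (evalGen_res_map hf F)
  have hb := (freeSheafHomEquiv (U₀ hf) F).bijective
  rw [← h] at hb
  exact (Function.Bijective.of_comp_iff' (evalGen_bijective hf _) _).mp hb

/-! ### All degrees: `Extⁿ_X(ℤ[h_{U₀}], F) ≅ Extⁿ_Y(ℤ[h_{U₀}]|_Y, F|_Y)` -/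

/-- `ℤ_Y ≅ ℤ[h_{U₀}]|_Y` (through `ℤ[h_⊤] ≅ ℤ_Y` on `Y`, `freeSheafIsoConstantSheaf`). [folklore] -/
def constantSheafIsoRes :
    (constantSheaf (Opens.grothendieckTopology Y) AddCommGrpCat.{u}).obj Zu ≅
      (res hf).obj (freeSheaf.{u} (Opens.grothendieckTopology X) (U₀ hf)) :=
  (freeSheafIsoConstantSheaf.{u} (isTerminalTop : IsTerminal (⊤ : Opens Y))).symm ≪≫
    freeSheafTopIso hf

section Ext

/-- **`Extⁿ_Y(ℤ[h_{U₀}]|_Y, I|_Y) = 0` for `I` injective on `X` and `n > 0`**: `I|_Y` is flasque, hence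
acyclic (Hartshorne III.2.4, III.2.5: `Motives/FlasqueCohomology`), and `ℤ[h_{U₀}]|_Y ≅ ℤ_Y`.
[cite: Hartshorne1977, III Prop. 2.5] -/
theorem subsingleton_ext_res_of_injective (I : Sheaf (Opens.grothendieckTopology X) AddCommGrpCat.{u})
    [Injective I] (n : ℕ) :
    Subsingleton (Ext.{u} ((res hf).obj (freeSheaf.{u} (Opens.grothendieckTopology X) (U₀ hf)))
      ((res hf).obj I) (n + 1)) := by
  haveI := Literature.AlgebraicGeometry.Motives.isFlasque_of_injective I
  haveI := isFlasque_res hf I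
  haveI : Subsingleton (Sheaf.H.{u} ((res hf).obj I) (n + 1)) :=
    Literature.AlgebraicGeometry.Motives.subsingleton_H_of_isFlasque _ _ (Nat.succ_pos n)
  exact Ext.subsingleton_of_iso_left (constantSheafIsoRes hf) (n + 1)

attribute [local simp] Ext.mapExactFunctor_comp Ext.mapExactFunctor_mk₀
  Ext.mapExactFunctor_extClass in
/-- **The cohomology of an open subspace is computed on the ambient site.** For an open embedding
`f : Y → X` with image `U₀` and every abelian sheaf `F` on `X`, restriction induces bijections
`Extⁿ_X(ℤ[h_{U₀}], F) ≅ Extⁿ_Y(ℤ[h_{U₀}]|_Y, F|_Y)` (`= Hⁿ(Y, F|_Y)`, as `ℤ[h_{U₀}]|_Y ≅ ℤ_Y`,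
`constantSheafIsoRes`) for all `n` — i.e. `Hⁿ(U₀, F) := Extⁿ(ℤ[h_{U₀}], F)` IS the sheaf
cohomology of the open subspace `U₀ ≅ Y` with coefficients in `F|_{U₀}` (The Stacks Project, Tag 01E1
= Cohomology of Sheaves, Lemma 20.7.1(2): "`Hᵖ(U, ℱ) = Hᵖ(U, ℱ|_U)`"; on sites Tag 03F3 = Cohomology
on Sites, Lemma 21.7.1(2): "`Hᵖ(U, ℱ) = Hᵖ(𝒞/U, ℱ|_{𝒞/U})`"). Proof: dimension shifting along
`0 → F → I → Q → 0` — restriction is exact, `I|_Y` is flasque hence acyclic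
(`subsingleton_ext_res_of_injective`), and in degree `0` both sides are `F(U₀)`
(`res_map_bijective`); the four lemma as in Mathlib's
`Functor.mapExt_bijective_of_preservesInjectiveObjects`. [cite: StacksProject, Tag 01E1] -/
theorem mapExt_bijective (F : Sheaf (Opens.grothendieckTopology X) AddCommGrpCat.{u}) (n : ℕ) :
    Function.Bijective ((res hf).mapExtAddHom
      (freeSheaf.{u} (Opens.grothendieckTopology X) (U₀ hf)) F n) := by
  induction n generalizing F with
  | zero =>
    rw [Functor.mapExtAddHom_coe, Ext.mapExactFunctor₀]
    exact (Equiv.bijective _).comp ((res_map_bijective hf F).comp (Equiv.bijective _))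
  | succ n hn =>
    let I : InjectivePresentation F := Classical.arbitrary _
    let S := ShortComplex.mk _ _ (cokernel.condition I.f)
    haveI : Injective S.X₂ := I.injective
    have hS : S.ShortExact := { exact := ShortComplex.exact_cokernel I.f }
    haveI : Subsingleton (Ext.{u} ((res hf).obj (freeSheaf.{u} (Opens.grothendieckTopology X) (U₀ hf)))
        (S.map (res hf)).X₂ (n + 1)) :=
      subsingleton_ext_res_of_injective hf S.X₂ n
    haveI := Ext.subsingleton_of_injective.{u}
      (freeSheaf.{u} (Opens.grothendieckTopology X) (U₀ hf)) S.X₂ n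
    exact AddMonoidHom.bijective_of_surjective_of_bijective_of_right_exact _ _ _ _
      ((res hf).mapExtAddHom _ S.X₂ n) ((res hf).mapExtAddHom _ S.X₃ n)
      ((res hf).mapExtAddHom _ S.X₁ (n + 1))
      (by cat_disch) (by cat_disch)
      ((ShortComplex.ab_exact_iff_function_exact _).mp
        (Ext.covariant_sequence_exact₃' _ hS n (n + 1) rfl))
      ((ShortComplex.ab_exact_iff_function_exact _).mp
        (Ext.covariant_sequence_exact₃' _ (hS.map (res hf)) n (n + 1) rfl))
      (hn _).surjective (hn _)
      (fun x₁ => Ext.covariant_sequence_exact₁ _ hS x₁ (Subsingleton.elim _ _) rfl)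
      (fun y₁ => Ext.covariant_sequence_exact₁ _ (hS.map (res hf)) y₁ (Subsingleton.elim _ _) rfl)

/-- **Restriction is injective on `Extⁿ_X(B, F)` for any model `B ≅ ℤ[h_{U₀}]`** of the free abelian
sheaf on the image (e.g. Mathlib's `ℤ[yoneda U₀]^#` underlying `Sheaf.cohomologyPresheaf`, or the
constant sheaf `ℤ_X` when `f` is surjective). [cite: StacksProject, Tag 01E1] -/
theorem mapExt_injective_of_iso {B : Sheaf (Opens.grothendieckTopology X) AddCommGrpCat.{u}}
    (e : B ≅ freeSheaf.{u} (Opens.grothendieckTopology X) (U₀ hf))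
    (F : Sheaf (Opens.grothendieckTopology X) AddCommGrpCat.{u}) (n : ℕ) :
    Function.Injective ((res hf).mapExtAddHom B F n) := by
  rw [injective_iff_map_eq_zero]
  intro y hy
  rw [Functor.mapExtAddHom_apply] at hy
  have h1 : ((Ext.mk₀ e.inv).comp y (zero_add n)).mapExactFunctor (res hf) = 0 := by
    rw [Ext.mapExactFunctor_comp, hy]
    exact Ext.comp_zero _ _ _ _ _
  have h2 : (Ext.mk₀ e.inv).comp y (zero_add n) = 0 :=
    (injective_iff_map_eq_zero _).mp (mapExt_bijective hf F n).1 _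
      (by rwa [Functor.mapExtAddHom_apply])
  calc y = (Ext.mk₀ e.hom).comp ((Ext.mk₀ e.inv).comp y (zero_add n)) (zero_add n) := by
          rw [Ext.mk₀_comp_mk₀_assoc, Iso.hom_inv_id, Ext.mk₀_id_comp]
    _ = 0 := by rw [h2]; exact Ext.comp_zero _ _ _ _ _

/-- **A class on `X` that dies on the open subspace dies on `ℤ[h_{U₀}]`**: if `y ∈ Extⁿ_X(A, F)`
restricts to `0` in `Extⁿ_Y(A|_Y, F|_Y)`, then `y ∘ g = 0` for every `g : B ⟶ A` from a model
`B ≅ ℤ[h_{U₀}]` (typically `A = ℤ[h_⊤]` or `ℤ_X` and `g` the inclusion `ℤ[h_{U₀}] → ℤ[h_⊤]`): the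
kernel of restriction to an open is contained in the kernel of `Hⁿ(X, F) → Hⁿ(U₀, F)` computed on the
site of `X`. [cite: StacksProject, Tag 01E1] -/
theorem mk₀_comp_eq_zero_of_mapExactFunctor_eq_zero
    {A B : Sheaf (Opens.grothendieckTopology X) AddCommGrpCat.{u}} (g : B ⟶ A)
    (e : B ≅ freeSheaf.{u} (Opens.grothendieckTopology X) (U₀ hf))
    {F : Sheaf (Opens.grothendieckTopology X) AddCommGrpCat.{u}} {n : ℕ} (y : Ext.{u} A F n)
    (hy : y.mapExactFunctor (res hf) = 0) : (Ext.mk₀ g).comp y (zero_add n) = 0 := by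
  apply mapExt_injective_of_iso hf e F n
  rw [map_zero, Functor.mapExtAddHom_apply, Ext.mapExactFunctor_comp, hy]
  exact Ext.comp_zero _ _ _ _ _

/-- The case of an open `U ⊆ X` (`f` the inclusion of `U`, whose image is `U`:
`Opens.isOpenEmbedding_obj_top`): **if `y ∈ Extⁿ_X(A, F)` restricts to `0` over `U`, then
`y ∘ g = 0` for every `g : B ⟶ A` with `B ≅ ℤ[h_U]`.** [cite: StacksProject, Tag 01E1] -/
theorem mk₀_comp_eq_zero_of_mapExactFunctor_restrict_eq_zero {X : TopCat.{u}} (U : Opens X)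
    {A B : Sheaf (Opens.grothendieckTopology X) AddCommGrpCat.{u}} (g : B ⟶ A)
    (e : B ≅ freeSheaf.{u} (Opens.grothendieckTopology X) U)
    {F : Sheaf (Opens.grothendieckTopology X) AddCommGrpCat.{u}} {n : ℕ} (y : Ext.{u} A F n)
    (hy : y.mapExactFunctor (restrict U.isOpenEmbedding AddCommGrpCat.{u}) = 0) :
    (Ext.mk₀ g).comp y (zero_add n) = 0 :=
  mk₀_comp_eq_zero_of_mapExactFunctor_eq_zero U.isOpenEmbedding g
    (e ≪≫ eqToIso (by rw [U₀, ι, Opens.isOpenEmbedding_obj_top])) y hy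

end Ext

end OpenSubspaceCohomology

end Literature.Topology

end
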